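import Literature.MathematicalPhysics.QuantumFieldTheory.QuasiLocalGaugePerturbationWilson
import Summits.QuantumFields.QCD.Theorems.NestedDissectionSeaRobustYangMillsRGStubSU3SignSet
import HarnessLib

/-!
# Toolkit for `stub_formatBallClustering_false` (line `birth`, crux `RobustYangMillsRG`,
# item stmt-QuantumFields-17812), part III: the `SU(3)` sign function, sign sites, the rough region

* the SIGN FUNCTION on `SU(3)` (`exists_signFunction`, registered as
  `stub_formatBallClustering_signFunction`): from `stub_su3SignSet` a measurable
  `φ : SU(3) → [-1, 1]` whose Haar moments `m_j = ∫ φ^j` satisfy `0 < m₁ ≤ 1`, `m₁ < m₂`,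
  `0 ≤ m₃ ≤ m₁` (`φ = (θ + c)/(1 + c)`, `θ = 1_S - 1_S(g₀ ·)`, `c = 3q/2`; no Haar integral is
  computed: only left invariance and `q ≤ 1/3` are used);
* the SIGN SITES `(0, 2k, 0, 0)`, `2k + 2 ≤ M`, of the block torus `(ZMod M)^4` (time-zero,
  SHIFT-FREE: `y' + eᵢ ≠ y` for sign sites `y, y'`; at least `n₀` of them once `2 n₀ + 2 ≤ M`);
* the format's ROUGH REGION `LF₁(V) = {y | ∃ i j, 1 < 3 - Re tr V_{y;ij}}` at `ε = 1` (stated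
  verbatim as the format's `Finset.filter`, no new definition): locality, gauge invariance,
  measurability of `{V | y ∈ LF₁ V}`, slab support, invariance of the OTHER sign sites' roughness
  under a one-link modification at a sign site, and the rough-plaquette criterion
  `V(y,2) a R(V)` rough ⇒ `y ∈ LF₁(V[(y,2) ↦ V(y,2) a])`.
-/

noncomputable section

namespace Summit.QuantumFields.QCD.Cruxes.RobustYangMillsRG.Birth

open scoped BigOperators Topology Manifold Classical MeasureTheory ProbabilityTheory Matrix InnerProductSpace ComplexConjugate ContinuousMap
open Filter Set Function TopologicalSpace MeasureTheory
open Literature.MathematicalPhysics.QuantumLattice Literature.MathematicalPhysics.AQFT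
  Literature.MathematicalPhysics.QuantumFieldTheory
open Summit.QuantumFields.QCD.Theorems.RobustYangMillsRG.Negative (SU3)

namespace SignedFormat

/-! ### The sign function on `SU(3)` -/

section Sign

/-- **The sign function.** A measurable `φ : SU(3) → [-1, 1]` whose first three Haar moments
`m_j = ∫ φ^j` satisfy `0 < m₁ ≤ 1`, `m₁ < m₂` and `0 ≤ m₃ ≤ m₁`. Construction: with the sign set
`S` (Haar mass `q ∈ (0, 1/3]`) and the element `g₀` moving `S` off itself of `stub_su3SignSet`,
`θ := 1_S - 1_S(g₀ ·)` takes values in `{-1, 0, 1}`, `∫ θ = 0` (left invariance), `θ² = 1_S + 1_S(g₀ ·)`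
(so `∫ θ² = 2q`), `θ³ = θ`; then `φ := (θ + c)/(1 + c)` with `c := 3q/2` has
`m₁ = c/(1+c)`, `m₂ = (2q + c²)/(1+c)²`, `m₃ = (6cq + c³)/(1+c)³`, and the inequalities reduce to
`c < 2q` and `3q ≤ 1`. [folklore] -/
theorem exists_signFunction :
    ∃ φ : SU3 → ℝ, Measurable φ ∧ (∀ u, |φ u| ≤ 1) ∧
      0 < ∫ u, φ u ∂haarProbability SU3 ∧ ∫ u, φ u ∂haarProbability SU3 ≤ 1 ∧
      ∫ u, φ u ∂haarProbability SU3 < ∫ u, φ u ^ 2 ∂haarProbability SU3 ∧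
      0 ≤ ∫ u, φ u ^ 3 ∂haarProbability SU3 ∧
      ∫ u, φ u ^ 3 ∂haarProbability SU3 ≤ ∫ u, φ u ∂haarProbability SU3 := by
  obtain ⟨⟨S, g₀, hS, hq, hq3, hmove⟩, -, -⟩ := stub_su3SignSet
  set μ : Measure SU3 := haarProbability SU3 with hμ
  set q : ℝ := μ.real S with hqdef
  set c : ℝ := 3 * q / 2 with hc
  have hc0 : 0 < c := by rw [hc]; linarith
  have hc1 : 0 < 1 + c := by linarith
  -- the indicator and its translate
  set χ : SU3 → ℝ := S.indicator 1 with hχ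
  have hχm : Measurable χ := measurable_one.indicator hS
  have hχi : Integrable χ μ := (integrable_const (1 : ℝ)).indicator hS
  have hχgi : Integrable (fun u => χ (g₀ * u)) μ := hχi.comp_mul_left g₀
  have hIχ : ∫ u, χ u ∂μ = q := integral_indicator_one hS
  have hIχg : ∫ u, χ (g₀ * u) ∂μ = q := by
    rw [integral_mul_left_eq_self (fun u => χ u) g₀]; exact hIχ
  -- θ and its pointwise algebra
  set θ : SU3 → ℝ := fun u => χ u - χ (g₀ * u) with hθ
  have hθm : Measurable θ := hχm.sub (hχm.comp (measurable_const_mul g₀))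
  have hθi : Integrable θ μ := hχi.sub hχgi
  have hθvals : ∀ u, (θ u ^ 2 = χ u + χ (g₀ * u)) ∧ θ u ^ 3 = θ u ∧ |θ u| ≤ 1 := by
    intro u
    by_cases hu : u ∈ S
    · have hgu : g₀ * u ∉ S := hmove u hu
      simp only [hθ, hχ, Set.indicator_of_mem hu, Set.indicator_of_notMem hgu, Pi.one_apply]
      norm_num
    · by_cases hgu : g₀ * u ∈ S
      · simp only [hθ, hχ, Set.indicator_of_notMem hu, Set.indicator_of_mem hgu, Pi.one_apply]
        norm_num
      · simp only [hθ, hχ, Set.indicator_of_notMem hu, Set.indicator_of_notMem hgu]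
        norm_num
  have hIθ : ∫ u, θ u ∂μ = 0 := by
    show ∫ u, (χ u - χ (g₀ * u)) ∂μ = 0
    rw [integral_sub hχi hχgi, hIχ, hIχg, sub_self]
  have hθ2 : (fun u => θ u ^ 2) = fun u => χ u + χ (g₀ * u) := funext fun u => (hθvals u).1
  have hθ3 : (fun u => θ u ^ 3) = θ := funext fun u => (hθvals u).2.1
  have hIθ2 : ∫ u, θ u ^ 2 ∂μ = 2 * q := by
    rw [hθ2, integral_add hχi hχgi, hIχ, hIχg]; ring
  have hθ2i : Integrable (fun u => θ u ^ 2) μ := by rw [hθ2]; exact hχi.add hχgi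
  have hIθ3 : ∫ u, θ u ^ 3 ∂μ = 0 := by rw [hθ3]; exact hIθ
  have hθ3i : Integrable (fun u => θ u ^ 3) μ := by rw [hθ3]; exact hθi
  -- φ and its moments
  refine ⟨fun u => (θ u + c) / (1 + c), hθm.add_const c |>.div_const _, fun u => ?_, ?_⟩
  · -- `|φ| ≤ 1`
    rw [abs_div, abs_of_pos hc1, div_le_one hc1]
    have h := abs_le.1 (hθvals u).2.2
    exact abs_le.2 ⟨by linarith, by linarith⟩
  have hm1 : ∫ u, (θ u + c) / (1 + c) ∂μ = c / (1 + c) := by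
    rw [integral_div, integral_add hθi (integrable_const c), hIθ, integral_const, probReal_univ,
      one_smul, zero_add]
  have hm2 : ∫ u, ((θ u + c) / (1 + c)) ^ 2 ∂μ = (2 * q + c ^ 2) / (1 + c) ^ 2 := by
    have h : (fun u => ((θ u + c) / (1 + c)) ^ 2) =
        fun u => (θ u ^ 2 + 2 * c * θ u + c ^ 2) / (1 + c) ^ 2 := by
      funext u; rw [div_pow]; ring
    have hi : Integrable (fun u => θ u ^ 2 + 2 * c * θ u) μ := hθ2i.add (hθi.const_mul _)
    rw [h, integral_div, integral_add hi (integrable_const _),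
      integral_add hθ2i (hθi.const_mul _), integral_const_mul, hIθ2, hIθ, integral_const,
      probReal_univ, one_smul]
    ring
  have hm3 : ∫ u, ((θ u + c) / (1 + c)) ^ 3 ∂μ = (6 * c * q + c ^ 3) / (1 + c) ^ 3 := by
    have h : (fun u => ((θ u + c) / (1 + c)) ^ 3) =
        fun u => (θ u ^ 3 + 3 * c * θ u ^ 2 + 3 * c ^ 2 * θ u + c ^ 3) / (1 + c) ^ 3 := by
      funext u; rw [div_pow]; ring
    have hi₁ : Integrable (fun u => θ u ^ 3 + 3 * c * θ u ^ 2) μ := hθ3i.add (hθ2i.const_mul _)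
    have hi₂ : Integrable (fun u => θ u ^ 3 + 3 * c * θ u ^ 2 + 3 * c ^ 2 * θ u) μ :=
      hi₁.add (hθi.const_mul _)
    rw [h, integral_div, integral_add hi₂ (integrable_const _), integral_add hi₁ (hθi.const_mul _),
      integral_add hθ3i (hθ2i.const_mul _), integral_const_mul, integral_const_mul, hIθ3, hIθ2,
      hIθ, integral_const, probReal_univ, one_smul]
    ring
  rw [hm1, hm2, hm3]
  refine ⟨div_pos hc0 hc1, (div_le_one hc1).2 (by linarith), ?_, by positivity, ?_⟩
  · rw [div_lt_div_iff₀ hc1 (by positivity)]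
    have h : (2 * q + c ^ 2) * (1 + c) - c * (1 + c) ^ 2 = (1 + c) * (q / 2) := by
      rw [hc]; ring
    nlinarith [mul_pos hc1 (half_pos hq)]
  · rw [div_le_div_iff₀ (by positivity) hc1]
    have h : c * (1 + c) ^ 3 - (6 * c * q + c ^ 3) * (1 + c) = c * (1 + c) * (1 - 3 * q) := by
      rw [hc]; ring
    nlinarith [mul_nonneg (mul_pos hc0 hc1).le (show (0 : ℝ) ≤ 1 - 3 * q by linarith)]

end Sign

/-! ### Sign sites: the slab sites `(0, 2k, 0, 0)`, `2k + 2 ≤ M` -/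

section Sites

variable {M : ℕ} [NeZero M]

/-- **Sign sites are shift-free**: no sign site (time `0`, coordinates `2, 3` zero, coordinate `1`
of even representative with `+2 ≤ M`) is a lattice neighbour `y' + eᵢ` of another or of itself:
directions `0, 2, 3` leave the coordinate hyperplanes, direction `1` changes the parity of the
representative (no wrap-around). [folklore] -/
theorem shift_ne_of_signSite (hM : 3 ≤ M) {y y' : Site 4 M}
    (hy : y 0 = 0 ∧ y 2 = 0 ∧ y 3 = 0 ∧ Even (y 1).val ∧ (y 1).val + 2 ≤ M)
    (hy' : y' 0 = 0 ∧ y' 2 = 0 ∧ y' 3 = 0 ∧ Even (y' 1).val ∧ (y' 1).val + 2 ≤ M) (i : Fin 4) :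
    y'.shift i ≠ y := by
  haveI : Fact (1 < M) := ⟨by omega⟩
  obtain ⟨h0, h2, h3, he, -⟩ := hy
  obtain ⟨h0', h2', h3', he', hle'⟩ := hy'
  intro h
  have hi : y' i + 1 = y i := by
    have := congrFun h i
    simpa [Site.shift] using this
  fin_cases i
  · simp only [Fin.zero_eta] at hi
    rw [h0, h0', zero_add] at hi
    exact one_ne_zero hi
  · simp only [Fin.mk_one] at hi
    have hval : (y 1).val = (y' 1).val + 1 := by
      rw [← hi, ZMod.val_add, ZMod.val_one, Nat.mod_eq_of_lt (by omega)]
    rw [hval] at he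
    exact (Nat.even_add_one.1 he) he'
  · simp only [Fin.reduceFinMk] at hi
    rw [h2, h2', zero_add] at hi
    exact one_ne_zero hi
  · simp only [Fin.reduceFinMk] at hi
    rw [h3, h3', zero_add] at hi
    exact one_ne_zero hi

/-- **There are many sign sites**: `n₀ ≤ #T` once `2 n₀ + 2 ≤ M` (the sites `(0, 2k, 0, 0)`,
`k < n₀`, are distinct sign sites). [folklore] -/
theorem le_card_filter_signSite {n₀ : ℕ} (hM : 2 * n₀ + 2 ≤ M) :
    n₀ ≤ (Finset.univ.filter fun y : Site 4 M =>
      y 0 = 0 ∧ y 2 = 0 ∧ y 3 = 0 ∧ Even (y 1).val ∧ (y 1).val + 2 ≤ M).card := by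
  let f : ℕ → Site 4 M := fun k => Pi.single 1 ((2 * k : ℕ) : ZMod M)
  have hval : ∀ k, k < n₀ → (((2 * k : ℕ) : ZMod M)).val = 2 * k := fun k hk => by
    rw [ZMod.val_natCast, Nat.mod_eq_of_lt (by omega)]
  calc n₀ = (Finset.range n₀).card := (Finset.card_range n₀).symm
    _ ≤ _ := by
      refine Finset.card_le_card_of_injOn f (fun k hk => ?_) ?_
      · have hk : k < n₀ := Finset.mem_range.1 hk
        refine Finset.mem_filter.2 ⟨Finset.mem_univ _, by simp [f], by simp [f], by simp [f], ?_, ?_⟩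
        · simp only [f, Pi.single_eq_same, hval k hk]; exact even_two_mul k
        · simp only [f, Pi.single_eq_same, hval k hk]; omega
      · intro k hk k' hk' hkk'
        have hk : k < n₀ := Finset.mem_range.1 hk
        have hk' : k' < n₀ := Finset.mem_range.1 hk'
        have h1 : ((2 * k : ℕ) : ZMod M) = ((2 * k' : ℕ) : ZMod M) := by
          have := congrFun hkk' 1
          simpa [f] using this
        have h2 := congrArg ZMod.val h1
        rw [hval k hk, hval k' hk'] at h2
        omega

omit [NeZero M] in
/-- The time coordinate of a neighbour `y + eᵢ` of a time-zero site is `0` or `1`, hence has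
representative `< 2`. [folklore] -/
theorem val_shift_zero_lt_two {y : Site 4 M} (hy : y 0 = 0) (i : Fin 4) :
    ((y.shift i) 0).val < 2 := by
  have h1 : (Pi.single (M := fun _ : Fin 4 => ZMod M) i (1 : ZMod M) 0).val ≤ 1 := by
    rw [Pi.single_apply]
    split_ifs
    · rw [ZMod.val_one_eq_one_mod]; exact Nat.mod_le 1 M
    · rw [ZMod.val_zero]; exact Nat.zero_le 1
  simp only [Site.shift, Pi.add_apply, hy, zero_add]
  omega

end Sites

/-! ### The rough (large-field) region `LF₁(V)` of the format at `ε = 1` -/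

section Rough

variable {M : ℕ} [NeZero M]

/-- Locality of roughness: whether `y` is rough only depends on the links based at `y` and at its
neighbours `y + eᵢ`. [folklore] -/
theorem mem_roughFilter_congr {V V' : GaugeConfig 4 M SU3} {y : Site 4 M}
    (h1 : ∀ i, V (y, i) = V' (y, i)) (h2 : ∀ i j, V (y.shift i, j) = V' (y.shift i, j)) :
    y ∈ (Finset.univ.filter fun y => ∃ i j : Fin 4,
        (1 : ℝ) < 3 - (fundamentalRep (Fin 3) (plaquetteHolonomy V y i j)).trace.re) ↔
      y ∈ (Finset.univ.filter fun y => ∃ i j : Fin 4,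
        (1 : ℝ) < 3 - (fundamentalRep (Fin 3) (plaquetteHolonomy V' y i j)).trace.re) := by
  have h : ∀ i j, plaquetteHolonomy V y i j = plaquetteHolonomy V' y i j := fun i j => by
    simp only [plaquetteHolonomy, h1, h2]
  simp only [Finset.mem_filter, Finset.mem_univ, true_and, h]

/-- Plaquette variables transform by conjugation under gauge transformations, so their traces are
invariant. [folklore] -/
theorem trace_plaquetteHolonomy_gaugeTransform {d L N : ℕ} {G : Type*} [Group G]
    (ρ : G →* Matrix (Fin N) (Fin N) ℂ) (g : Site d L → G) (V : GaugeConfig d L G) (x : Site d L)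
    (i j : Fin d) :
    (ρ (plaquetteHolonomy (gaugeTransform g V) x i j)).trace = (ρ (plaquetteHolonomy V x i j)).trace := by
  have hshift : (x.shift j).shift i = (x.shift i).shift j := by
    simp only [Site.shift, add_assoc, add_comm (Pi.single (M := fun _ => ZMod L) j 1)]
  have hhol : plaquetteHolonomy (gaugeTransform g V) x i j =
      g x * plaquetteHolonomy V x i j * (g x)⁻¹ := by
    simp only [plaquetteHolonomy, gaugeTransform, hshift, mul_inv_rev, inv_inv]
    group
  rw [hhol, map_mul, map_mul, Matrix.trace_mul_cycle, ← map_mul, inv_mul_cancel, map_one, one_mul]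

/-- The rough region is gauge invariant. [folklore] -/
theorem roughFilter_gaugeTransform (g : Site 4 M → SU3) (V : GaugeConfig 4 M SU3) :
    (Finset.univ.filter fun y => ∃ i j : Fin 4,
        (1 : ℝ) < 3 - (fundamentalRep (Fin 3) (plaquetteHolonomy (gaugeTransform g V) y i j)).trace.re) =
      Finset.univ.filter fun y => ∃ i j : Fin 4,
        (1 : ℝ) < 3 - (fundamentalRep (Fin 3) (plaquetteHolonomy V y i j)).trace.re := by
  ext y
  simp only [Finset.mem_filter, Finset.mem_univ, true_and, trace_plaquetteHolonomy_gaugeTransform]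

/-- The event `{V | y ∈ LF(V)}` is measurable (a finite union of open sets pulled back along the
measurable plaquette-variable maps). [folklore] -/
theorem measurableSet_mem_roughFilter (y : Site 4 M) :
    MeasurableSet {V : GaugeConfig 4 M SU3 | y ∈ (Finset.univ.filter fun y => ∃ i j : Fin 4,
      (1 : ℝ) < 3 - (fundamentalRep (Fin 3) (plaquetteHolonomy V y i j)).trace.re)} := by
  have h : ∀ i j : Fin 4, MeasurableSet {V : GaugeConfig 4 M SU3 |
      (1 : ℝ) < 3 - (fundamentalRep (Fin 3) (plaquetteHolonomy V y i j)).trace.re} := by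
    intro i j
    refine measurableSet_lt measurable_const ?_
    have hhol : Measurable fun V : GaugeConfig 4 M SU3 => plaquetteHolonomy V y i j := by
      unfold plaquetteHolonomy; fun_prop
    exact (continuous_const.sub (Complex.continuous_re.comp
      ((continuous_fundamentalRep (Fin 3)).matrix_trace))).measurable.comp hhol
  simp only [Finset.mem_filter, Finset.mem_univ, true_and, Set.setOf_exists]
  exact MeasurableSet.iUnion fun i => MeasurableSet.iUnion fun j => h i j

/-- For a time-zero site `y`, roughness at `y` and the link `V (y, 1)` only see links of time `< 2`. [folklore] -/
theorem roughFilter_congr_slab {V V' : GaugeConfig 4 M SU3} {y : Site 4 M} (hy : y 0 = 0)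
    (hVV' : ∀ e : Edge 4 M, (e.1 0).val < 2 → V e = V' e) :
    (y ∈ (Finset.univ.filter fun y => ∃ i j : Fin 4,
        (1 : ℝ) < 3 - (fundamentalRep (Fin 3) (plaquetteHolonomy V y i j)).trace.re) ↔
      y ∈ (Finset.univ.filter fun y => ∃ i j : Fin 4,
        (1 : ℝ) < 3 - (fundamentalRep (Fin 3) (plaquetteHolonomy V' y i j)).trace.re)) ∧
      V (y, 1) = V' (y, 1) := by
  have h1 : ∀ i, V (y, i) = V' (y, i) := fun i => hVV' _ (by simp [hy])
  exact ⟨mem_roughFilter_congr h1 fun i j => hVV' _ (val_shift_zero_lt_two hy i), h1 1⟩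

/-- Modifying the link `(y, k)` of a sign site `y` does not change the roughness of the OTHER sign
sites (their plaquettes do not contain that link, by shift-freeness). [folklore] -/
theorem mem_roughFilter_update_of_ne (hM : 3 ≤ M) {y y' : Site 4 M}
    (hy : y 0 = 0 ∧ y 2 = 0 ∧ y 3 = 0 ∧ Even (y 1).val ∧ (y 1).val + 2 ≤ M)
    (hy' : y' 0 = 0 ∧ y' 2 = 0 ∧ y' 3 = 0 ∧ Even (y' 1).val ∧ (y' 1).val + 2 ≤ M) (hne : y' ≠ y)
    (k : Fin 4) (V : GaugeConfig 4 M SU3) (a : SU3) :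
    y' ∈ (Finset.univ.filter fun x => ∃ i j : Fin 4, (1 : ℝ) < 3 -
        (fundamentalRep (Fin 3) (plaquetteHolonomy (Function.update V (y, k) (V (y, k) * a)) x i j)).trace.re) ↔
      y' ∈ (Finset.univ.filter fun x => ∃ i j : Fin 4,
        (1 : ℝ) < 3 - (fundamentalRep (Fin 3) (plaquetteHolonomy V x i j)).trace.re) :=
  mem_roughFilter_congr (fun _ => Function.update_of_ne (fun h => hne (congrArg Prod.fst h)) _ V)
    fun i _ => Function.update_of_ne (fun h => shift_ne_of_signSite hM hy hy' i (congrArg Prod.fst h)) _ V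

/-- The `(2,3)` plaquette variable at a sign site `y` after right-multiplying the link `(y, 2)` by
`a`: `V_{y;23} = (V(y,2) a) · R(V)` with `R(V)` independent of `a`. [folklore] -/
theorem plaquetteHolonomy_update_two_three (hM : 3 ≤ M) {y : Site 4 M}
    (hy : y 0 = 0 ∧ y 2 = 0 ∧ y 3 = 0 ∧ Even (y 1).val ∧ (y 1).val + 2 ≤ M) (V : GaugeConfig 4 M SU3)
    (a : SU3) :
    plaquetteHolonomy (Function.update V (y, 2) (V (y, 2) * a)) y 2 3 =
      V (y, 2) * a * (V (y.shift 2, 3) * (V (y.shift 3, 2))⁻¹ * (V (y, 3))⁻¹) := by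
  have h2 : Function.update V (y, 2) (V (y, 2) * a) (y.shift 2, 3) = V (y.shift 2, 3) :=
    Function.update_of_ne (fun h => (by decide : (3 : Fin 4) ≠ 2) (congrArg Prod.snd h)) _ V
  have h3 : Function.update V (y, 2) (V (y, 2) * a) (y.shift 3, 2) = V (y.shift 3, 2) :=
    Function.update_of_ne (fun h => shift_ne_of_signSite hM hy hy 3 (congrArg Prod.fst h)) _ V
  have h4 : Function.update V (y, 2) (V (y, 2) * a) (y, 3) = V (y, 3) :=
    Function.update_of_ne (fun h => (by decide : (3 : Fin 4) ≠ 2) (congrArg Prod.snd h)) _ V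
  simp only [plaquetteHolonomy, Function.update_self, h2, h3, h4, mul_assoc]

/-- **The rough-plaquette criterion**: if `V(y,2) a R(V)` is a rough group element then `y` is a
rough site of the link-modified configuration. [folklore] -/
theorem mem_roughFilter_update_of_mem (hM : 3 ≤ M) {y : Site 4 M}
    (hy : y 0 = 0 ∧ y 2 = 0 ∧ y 3 = 0 ∧ Even (y 1).val ∧ (y 1).val + 2 ≤ M) (V : GaugeConfig 4 M SU3)
    (a : SU3)
    (h : V (y, 2) * a * (V (y.shift 2, 3) * (V (y.shift 3, 2))⁻¹ * (V (y, 3))⁻¹) ∈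
      {g : SU3 | (1 : ℝ) < 3 - (fundamentalRep (Fin 3) g).trace.re}) :
    y ∈ (Finset.univ.filter fun y' => ∃ i j : Fin 4, (1 : ℝ) < 3 -
      (fundamentalRep (Fin 3) (plaquetteHolonomy (Function.update V (y, 2) (V (y, 2) * a)) y' i j)).trace.re) := by
  refine Finset.mem_filter.2 ⟨Finset.mem_univ _, 2, 3, ?_⟩
  rw [plaquetteHolonomy_update_two_three hM hy V a]
  exact h

end Rough

end SignedFormat

/-! ### Registered sub-goal carried by this file -/

/-- **Registered sub-goal of Stub N3 carried by this support file** — the sign function on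
`SU(3)` (`SignedFormat.exists_signFunction`): a measurable `φ : SU(3) → [-1, 1]` with Haar moments
`0 < m₁ ≤ 1`, `m₁ < m₂`, `0 ≤ m₃ ≤ m₁`. [folklore] -/
theorem stub_formatBallClustering_signFunction : ∃ φ : ↥(Matrix.specialUnitaryGroup (Fin 3) ℂ) → ℝ, Measurable φ ∧ (∀ u, |φ u| ≤ 1) ∧ 0 < ∫ u, φ u ∂haarProbability ↥(Matrix.specialUnitaryGroup (Fin 3) ℂ) ∧ ∫ u, φ u ∂haarProbability ↥(Matrix.specialUnitaryGroup (Fin 3) ℂ) ≤ 1 ∧ ∫ u, φ u ∂haarProbability ↥(Matrix.specialUnitaryGroup (Fin 3) ℂ) < ∫ u, φ u ^ 2 ∂haarProbability ↥(Matrix.specialUnitaryGroup (Fin 3) ℂ) ∧ 0 ≤ ∫ u, φ u ^ 3 ∂haarProbability ↥(Matrix.specialUnitaryGroup (Fin 3) ℂ) ∧ ∫ u, φ u ^ 3 ∂haarProbability ↥(Matrix.specialUnitaryGroup (Fin 3) ℂ) ≤ ∫ u, φ u ∂haarProbability ↥(Matrix.specialUnitaryGroup (Fin 3) ℂ) :=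
  SignedFormat.exists_signFunction

end Summit.QuantumFields.QCD.Cruxes.RobustYangMillsRG.Birth
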